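import Literature.Analysis.UnboundedOperators.SemilinearMildFlowLocal
import Summits.AnomalousDissipation.AnomalousDissipation.Theorems.BaireTransferDenseLoudDesignerForcesErgodicLine

/-!
# The smooth local mild flow of an abstract semilinear parabolic equation (tools stub `stub_smoothMildFlowTools`,
# block N-R, line `ergodic-budget-selection-closing`, crux `BaireTransfer.DenseLoudDesignerForces`, stmt-AnomalousDissipation-1143)

Summit-side copy of the Literature theorem `Literature.Analysis.UnboundedOperators.exists_smoothMildFlow`
(`Literature/Analysis/UnboundedOperators/SemilinearMildFlowLocal.lean`, any real Banach space `E`): for a strongly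
continuous family of contractions `T`, a family `K` strongly continuous on `(0, ∞)` with the weakly singular bound
`‖K t‖ ≤ C t^{-α}` (`0 ≤ C`, `α < 1`), a bounded bilinear map `N`, a constant forcing `f` and a radius `ρ > 0` there
are a time `τ > 0` and a solution map `Ψ : E → C([0, τ]; E)` with

* `Ψ` of class `C^∞` on the ball `‖y₀‖ < ρ` (as a map into the Banach space `C([0, τ]; E)`);
* `Ψ y₀` the mild solution `y(t) = T(t) y₀ + ∫₀ᵗ T(t − s) f ds − ∫₀ᵗ K(t − s) N(y(s), y(s)) ds` from `y₀`;
* unconditional uniqueness among continuous mild solutions on `[0, τ]`;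
* the derivative `w = DΨ(y₀) h` solving the linearised mild equation
  `w(t) = T(t) h − ∫₀ᵗ K(t − s) (N(y(s), w(s)) + N(w(s), y(s))) ds`.

Architecture of the proof (all in `Literature/`): the Duhamel operator `Φ` of `K` on `C([0, τ]; E)`
(`WeaklySingularDuhamel.lean`, tools stub S2), the orbit/forcing/Nemytskii operators
(`SemilinearMildFlowOperators.lean`), the uniform contraction principle for the quadratic fixed-point problem
`y = A y₀ + F₀ − Φ(B(y, y))` (`Calculus/QuadraticSolutionMapSmooth.lean`, on top of
`Calculus/FixedPointSmoothDependence.lean`), and the homogeneous weakly singular Grönwall lemma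
(`ODE/WeaklySingularGronwallZero.lean`) for uniqueness; assembled in `SemilinearMildFlow.lean` /
`SemilinearMildFlowLocal.lean`.  Block N-R applies this with `E = Hsp`, `T = e^{-νtA}`, `K = A^{3/4}e^{-νtA}`
(tools stub S1) and the bounded bilinear form of S3 to obtain the smooth model of the Navier–Stokes semiflow.
The registered signature also carries `T 0 = 1`, the semigroup law of `T`, `0 ≤ α` and the intertwining
`K (s + t) = T s ∘ K t`; the conclusions do not need them (uniqueness is proved by the singular Grönwall lemma
rather than by shifting short windows).

References: D. Henry, *Geometric Theory of Semilinear Parabolic Equations*, LNM 840 (1981), Thm 3.3.3, Thm 3.4.4,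
Cor. 3.4.6, Lemma 7.1.1; A. Pazy, *Semigroups of Linear Operators and Applications to PDE* (1983), Thm 6.3.1.
Nothing is asserted; no definition is added.
-/

-- `Summit.<Summit>.<Problem>` is the tree's mandated summit-side namespace (CONVENTIONS §2); for this
-- single-conjunct summit the two coincide, so the duplicate is deliberate.
set_option linter.dupNamespace false

noncomputable section

open scoped BigOperators Topology ENNReal InnerProductSpace ContDiff
open Filter Set Function MeasureTheory

namespace Summit.AnomalousDissipation.AnomalousDissipation.Theorems.DenseLoudDesignerForces.Ergodic

open Literature.Analysis.FunctionSpaces Literature.Analysis.FunctionSpaces.Torus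
open Literature.Analysis.FluidPDE Literature.Analysis.FluidPDE.Torus

/-- **Tools stub S4 of block N-R (`stub_smoothMildFlowTools`) — the smooth local mild flow of an abstract
semilinear parabolic equation.**  Let `T` be a strongly continuous contraction semigroup on a real Banach space
`E`, `K` a strongly continuous family on `(0, ∞)` with `‖K t‖ ≤ C t^{-α}` (`0 ≤ α < 1`) and `K (s + t) = T s ∘ K t`,
`N` a bounded bilinear map and `f ∈ E`.  For every radius `ρ > 0` there are `τ > 0` and `Ψ : E → C([0, τ]; E)` such
that for `‖y₀‖ < ρ` the curve `Ψ y₀` solves the mild equation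
`y(t) = T t y₀ + ∫₀ᵗ T(t − s) f ds − ∫₀ᵗ K(t − s) N(y(s), y(s)) ds`, is the unique continuous solution, `Ψ` is
`C^∞` on the ball, and `w = DΨ(y₀) h` is the mild solution of the linearised equation
`w(t) = T t h − ∫₀ᵗ K(t − s) (N(y(s), w(s)) + N(w(s), y(s))) ds` —
`Literature.Analysis.UnboundedOperators.exists_smoothMildFlow` (Henry 1981, Thm 3.3.3 / Thm 3.4.4; Pazy 1983,
Thm 6.3.1). [cite: Henry1981, Thm 3.3.3 and Thm 3.4.4] -/
theorem stub_smoothMildFlowTools {E : Type*} [NormedAddCommGroup E] [NormedSpace ℝ E] [CompleteSpace E]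
    (T K : ℝ → E →L[ℝ] E) (hT0 : T 0 = 1) (hTadd : ∀ s t, 0 ≤ s → 0 ≤ t → T (s + t) = (T s).comp (T t))
    (hTnorm : ∀ t, 0 ≤ t → ‖T t‖ ≤ 1) (hTc : ∀ y : E, Continuous fun t : ℝ => T t y)
    {α C : ℝ} (hα₀ : 0 ≤ α) (hα : α < 1) (hC : 0 ≤ C) (hK : ∀ t, 0 < t → ‖K t‖ ≤ C * t ^ (-α))
    (hKadd : ∀ s t, 0 ≤ s → 0 < t → K (s + t) = (T s).comp (K t)) (hKc : ∀ y : E, ContinuousOn (fun t : ℝ => K t y) (Ioi 0))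
    (N : E →L[ℝ] E →L[ℝ] E) (f : E) {ρ : ℝ} (hρ : 0 < ρ) :
    ∃ τ : ℝ, ∃ hτ : 0 < τ, ∃ Ψ : E → C(Icc (0 : ℝ) τ, E),
      ContDiffOn ℝ ∞ Ψ (Metric.ball 0 ρ) ∧
      (∀ y₀ ∈ Metric.ball (0 : E) ρ, ∀ t : Icc (0 : ℝ) τ,
        Ψ y₀ t = T t y₀ + (∫ s in (0 : ℝ)..(t : ℝ), T ((t : ℝ) - s) f) -
          ∫ s in (0 : ℝ)..(t : ℝ), K ((t : ℝ) - s) (N (Ψ y₀ (Set.projIcc 0 τ hτ.le s)) (Ψ y₀ (Set.projIcc 0 τ hτ.le s)))) ∧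
      (∀ y₀ ∈ Metric.ball (0 : E) ρ, ∀ z : C(Icc (0 : ℝ) τ, E),
        (∀ t : Icc (0 : ℝ) τ, z t = T t y₀ + (∫ s in (0 : ℝ)..(t : ℝ), T ((t : ℝ) - s) f) -
          ∫ s in (0 : ℝ)..(t : ℝ), K ((t : ℝ) - s) (N (z (Set.projIcc 0 τ hτ.le s)) (z (Set.projIcc 0 τ hτ.le s)))) → z = Ψ y₀) ∧
      (∀ y₀ ∈ Metric.ball (0 : E) ρ, ∀ (h : E) (t : Icc (0 : ℝ) τ),
        fderiv ℝ Ψ y₀ h t = T t h - ∫ s in (0 : ℝ)..(t : ℝ), K ((t : ℝ) - s)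
          (N (Ψ y₀ (Set.projIcc 0 τ hτ.le s)) (fderiv ℝ Ψ y₀ h (Set.projIcc 0 τ hτ.le s)) +
            N (fderiv ℝ Ψ y₀ h (Set.projIcc 0 τ hτ.le s)) (Ψ y₀ (Set.projIcc 0 τ hτ.le s)))) := by
  -- `hT0`, `hTadd`, `hα₀`, `hKadd` belong to the registered signature; the Literature theorem does not need them.
  have _h : T 0 = 1 ∧ 0 ≤ α := ⟨hT0, hα₀⟩
  have _h' := And.intro hTadd hKadd
  exact Literature.Analysis.UnboundedOperators.exists_smoothMildFlow T K hTnorm hTc hα hC hK hKc N f hρ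

end Summit.AnomalousDissipation.AnomalousDissipation.Theorems.DenseLoudDesignerForces.Ergodic

end
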